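/-
Copyright (c) 2026 the pub-hodgecm-mathlib formalisation cell (harness21).  Prover seat hodgecm-mathlib-LH4-p14 (g2), req620 Track A «(D-RAM) FOUR-FRAME» squad
(unit U3_Laws, MS ROAD A Stage A₂ «RE-KEY tv = 2 ON MULTIPLICITY»; brick (O2b)-MULT dealt by LH4-p11 (g2)'s RULING 2026-09-04T00:53:03Z (3) under the heir LEAD's
RULING (R-21); Stage B lead LH4-p10 (g2); dealer LH4-plan (g11)).  2026-09-04.
-/
import Summits.HodgeConjecture.HodgeConjecture.Theorems.F0P3cDyRamDiagonalOrbitFibreCount      -- ★ (O2b) PART 3 (this seat): `v_unitNormMap_zpow`, PARTS 1–2 (representatives, transport, decomposition)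
import Summits.HodgeConjecture.HodgeConjecture.Theorems.F0P3cDyRamDiagonalOrbitAveraging      -- ★ (O2c) engine (LH4-p11 (g2)): `relIndex_fixedUnitStabilizer_ne_zero_of_finite`
import Mathlib.Tactic.LinearCombination
import Mathlib.Tactic.FieldSimp
import HarnessLib

/-!
# Crux `H413`, line LH4 «(D-RAM) FOUR-FRAME» road — unit U3_Laws (iii), MS ROAD A Stage A₂, brick (O2b)-MULT:
# THE FIBRE COUNT ALONG A UNIT-TORUS ORBIT WITH MULTIPLICITY
# `(Σ_{M ∈ 𝒯·M₀} #{(e, a) : diag(ϖ^{a})·M is a type-tv vertex of diag(c^{e})}) · [𝒰 : S_F(M₀)] = 8 · [𝒯 : S̃(M₀)] · #(Δ_tv(M₀) ∕ S_F(M₀))`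

Cell `hodgecm-mathlib` (D-0151), FLOOR 0, crux item H413 = `stmt-HodgeConjecture-24833`, route of record `HCCMUnconditional`; squad F0∕P3c∕LH4 (req618∕req620).  THEOREMS ONLY
(no `def`, no instance, no notation, no `sorry`); lane `--supports stmt-HodgeConjecture-24833 --as helper` (count-neutral).

WHY (the UNIQ₂ flag, LH4-p09 (g2) 2026-09-04T00:42:58Z; REF5 R5-75, LH4-r01 DJ∕DL, REF1 #130, LH-ref2 #5 «=»; heir LEAD RULING (R-21); LH4-p11 (g2) RULING 00:53:03Z).
★ (O2b) PART 3 `finsum_ncard_fibre_mul_relIndex_eq_of_exists` counted the fibres along a unit-torus orbit under the ONE-COSET hypothesis `hcoset` («the type-tv polarisations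
`Δ_tv(M₀) = {D σ-fixed non-degenerate : M₀ type-tv for diag D}` form ONE coset of `S_F(M₀)`»).  At `tv = 2` that hypothesis is FALSE on the glued strata with even `ρ ≥ 2`
(there `#(Δ₂(M₀)∕S_F(M₀)) = q`), and the true invariant weights each lattice by the COSET COUNT `n(M₀) := #(Δ_tv(M₀)∕S_F(M₀))` (★ `polarisationCount`, StrataDefs ED. 3).
THIS FILE proves the fibre identity WITH MULTIPLICITY and WITHOUT `hcoset`, in a definition-free currency: `Δ_tv(M₀)` is described as the disjoint union of the
`S_F(M₀)`-cosets of a finite set `reps` of representatives (`hΔ`, `hfree`), and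
  `(Σᶠ_{M ∈ 𝒯·M₀} #fibre_tv(M)) · [𝒰 : S_F(M₀)] = 8 · [𝒯 : S̃(M₀)] · #reps`
(`reps = {D₁}` is PART 3; `reps = ∅` is PART 3's vanishing head).  The `polarisationCount` currency (representatives chosen from ★ `polarisationCosets`, finiteness of the coset
set for members of `𝓛₀(T)`) is the follow-up file `…OrbitFibreCountMultHeads`.

THE MATHEMATICS (LH4-p10 MEMO-stableLaw-finite v1 §2 (3), re-keyed).  Write `𝒯 ⊇ 𝒰 ⊇ N𝒯 := N(𝒯)` (`N(z) = z·σz`, `[𝒰 : N𝒯] = 8` by (NI2), ★ PART 2), `S̃ = S̃(M₀)`, `S_F = S_F(M₀)`,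
`X := N⁻¹(S_F)`, `H := 𝒯 ∩ X`, `D_j = N(ϖu^{a_j})·w_j` (`w_j ∈ 𝒰`, ★ PART 2) for the representatives.  (1) Along `M = diag(u)·M₀` the fibre is
`{(e, a_j) : j, c^{e}·N(u)·w_j⁻¹ ∈ S_F}` (transport ★ PART 2 + `hΔ`; the pairs for distinct `j` are distinct by `hfree`), and the condition depends on `u` only through the class
`N(u)·S_F`.  (2) The map `u ↦ (diag(u)·M₀, N(u)·S_F)` has stabiliser `S̃ ∩ H`; counting the finite set `Ω` of its values in two ways: over the orbit, every `M ∈ 𝒯·M₀` carries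
`[S̃ : S̃ ∩ H]` classes, so `Σ_Ω #fibre = (Σ_{𝒯·M₀} #fibre)·[S̃ : S̃ ∩ H]`; over the classes, the class of `w_j·(c^{e})⁻¹` is hit by `[H : S̃ ∩ H]` lattices when `w_j⁻¹c^{e} ∈ N𝒯·S_F`
(★ PART 2 translate-of-an-`H`-orbit count) and by none otherwise, and for each `j` exactly `[N𝒯·S_F : N𝒯]` of the eight `e` qualify (★ PART 1, the `c^{e}` representing `𝒰 ∕ N𝒯`), so
`Σ_Ω #fibre = #reps · [N𝒯·S_F : N𝒯] · [H : S̃ ∩ H]`.  (3) Index algebra with NO `N(S̃) ≤ S_F` (which fails exactly when `#reps > 1` — `N(S̃)` permutes the cosets):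
`[N𝒯·S_F : N𝒯]·[𝒰 : S_F] = [𝒰 : N𝒯]·[𝒯 : H]` (§1) and `[S̃ : S̃∩H]·[𝒯 : S̃] = [H : S̃∩H]·[𝒯 : H]`, the finite non-zero `[S̃ : S̃∩H]`, `[𝒯 : H]` cancelling.
* §1 `relIndex_map_sup_mul_relIndex_eq` — the index identity (abstract commutative groups, `hNT` only).
* §2 `ncard_image_normClass_stabilizer`, `ncard_orbit_inter_normClass_eq_relIndex ∕ _eq_zero` — the two slice counts of `Ω`.
* §3 `finsum_ncard_fibre_mul_relIndex_eq_mul_card` — THE HEAD (letters of ★ PART 3∕4 token for token on the left; `8 * [𝒯 : S̃] * reps.card` on the right).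
HONEST LABEL.  Count-neutral (`--supports`); nothing printed is asserted; (MS) stays a PROVER TARGET; `HC_CM` is proved only modulo the 7 printed citations (2 remaining named inputs:
hLiu418 = `stmt-HodgeConjecture-24832`, h413 = `stmt-HodgeConjecture-24833`) until rung 0 closes.

## References
* [Kottwitz1986BaseChangeUnits] R. E. Kottwitz, *Base change for unit elements of Hecke algebras*, Compositio Math. 60 (1986), §1 pp. 240–241.
* [Rogawski1990] J. D. Rogawski, *Automorphic Representations of Unitary Groups in Three Variables*, Ann. of Math. Stud. 123 (1990), §4.9 Prop. 4.9.1 (a) p. 55.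
* [Serre1979] J.-P. Serre, *Local Fields*, GTM 67 (1979), Ch. V §3.
-/

set_option autoImplicit false

noncomputable section

namespace Summit.HodgeConjecture.HodgeConjecture.Cruxes.H413.F0P3cDyRamDiagonalOrbitFibreCountMult

open Matrix
open Literature.NumberTheory.Automorphic Literature.NumberTheory.Automorphic.HermitianLattice
open Literature.NumberTheory.Automorphic.UnitaryLatticeTree
open Summit.HodgeConjecture.HodgeConjecture.Cruxes.H413.F0P3cDyRamDiagonalTorusDefs
open Summit.HodgeConjecture.HodgeConjecture.Cruxes.H413.F0P3cDyRamDiagonalOrbitFibreTransport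
open Summit.HodgeConjecture.HodgeConjecture.Cruxes.H413.F0P3cDyRamTorusRepresentativesCount
open Summit.HodgeConjecture.HodgeConjecture.Cruxes.H413.F0P3cDyRamDiagonalPairReindex
open Summit.HodgeConjecture.HodgeConjecture.Cruxes.H413.F0P3cDyRamDiagonalOrbitFibreCount
open Summit.HodgeConjecture.HodgeConjecture.Cruxes.H413.F0P3cDyRamDiagonalOrbitAveraging (relIndex_fixedUnitStabilizer_ne_zero_of_finite)
open scoped Valued WithZero Matrix MatrixGroups

/-! ## §1  The index identity without `N(S̃) ≤ S_F` -/

/-- **INDEX IDENTITY (no `N(S̃) ≤ S_F`).**  In a commutative group with subgroups `T, U, S` and an endomorphism `N` with `A := N(T) ≤ U`, `S_F := S ⊓ U`, `H := T ⊓ N⁻¹(S_F)`: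
`[A ⊔ S_F : A] · [U : S_F] = [U : A] · [T : H]` in `ℕ` (every bracket a Mathlib `relIndex`; no finiteness hypothesis).  Proof: `[T : H] = [A : A ⊓ S_F] = [A ⊔ S_F : S_F]`
(`relIndex_comap` + diamond), `[U : A] = [U : A ⊔ S_F]·[A ⊔ S_F : A]`, `[U : S_F] = [U : A ⊔ S_F]·[A ⊔ S_F : S_F]`. [cite: Serre1979, Ch. V §3] -/
theorem relIndex_map_sup_mul_relIndex_eq {G : Type*} [CommGroup G] (T U S : Subgroup G) (N : G →* G) (hNT : T.map N ≤ U) :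
    (T.map N).relIndex (T.map N ⊔ S ⊓ U) * (S ⊓ U).relIndex U = (T.map N).relIndex U * (T ⊓ (S ⊓ U).comap N).relIndex T := by
  have hXU : T.map N ⊔ S ⊓ U ≤ U := sup_le hNT inf_le_right
  have e2 : (T ⊓ (S ⊓ U).comap N).relIndex T = (S ⊓ U).relIndex (T.map N) := by
    rw [inf_comm, Subgroup.inf_relIndex_right, Subgroup.relIndex_comap]
  have e4 : (S ⊓ U).relIndex (T.map N ⊔ S ⊓ U) = (S ⊓ U).relIndex (T.map N) := Subgroup.relIndex_sup_right _ _
  have e5 : (T.map N).relIndex (T.map N ⊔ S ⊓ U) * (T.map N ⊔ S ⊓ U).relIndex U = (T.map N).relIndex U :=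
    Subgroup.relIndex_mul_relIndex _ _ _ le_sup_left hXU
  have e6 : (S ⊓ U).relIndex (T.map N ⊔ S ⊓ U) * (T.map N ⊔ S ⊓ U).relIndex U = (S ⊓ U).relIndex U :=
    Subgroup.relIndex_mul_relIndex _ _ _ le_sup_right hXU
  rw [← e5, ← e6, e4, e2]
  ring

/-! ## §2  The two slice counts of `Ω = {(diag(u)·M₀, N(u)·S_F) : u ∈ 𝒯}` -/

variable {K : Type*} [Field K] [Valued K ℤᵐ⁰]

/-- **CLASSES OVER ONE LATTICE**: `#{N(u·s)·S_F(M₀) : s ∈ S̃(M₀)} = [S̃(M₀) : S̃(M₀) ∩ N⁻¹S_F(M₀)]` (as `(N⁻¹S_F).relIndex S̃`; the image of `S̃` under `S̃ → (K^×)³∕S_F`, `s ↦ N(us)·S_F`,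
a translate of the image of a homomorphism with kernel `S̃ ∩ N⁻¹S_F`). [cite: Kottwitz1986BaseChangeUnits, §1 pp. 240–241] -/
theorem ncard_image_normClass_stabilizer (σ : K →+* K) (M₀ : Submodule 𝒪[K] (Fin 3 → K)) (u : Fin 3 → Kˣ) :
    ((fun s : Fin 3 → Kˣ => QuotientGroup.mk' (fixedUnitStabilizer σ M₀) (unitNormMap σ 3 (u * s))) '' (unitStabilizer M₀ : Set (Fin 3 → Kˣ))).ncard
      = ((fixedUnitStabilizer σ M₀).comap (unitNormMap σ 3)).relIndex (unitStabilizer M₀) := by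
  set φ : (Fin 3 → Kˣ) →* (Fin 3 → Kˣ) ⧸ fixedUnitStabilizer σ M₀ :=
    (QuotientGroup.mk' (fixedUnitStabilizer σ M₀)).comp (unitNormMap σ 3) with hφ
  have hfun : (fun s : Fin 3 → Kˣ => QuotientGroup.mk' (fixedUnitStabilizer σ M₀) (unitNormMap σ 3 (u * s))) = fun s => φ u * φ s := by
    funext s
    rw [map_mul, map_mul]
    rfl
  have hker : φ.ker = (fixedUnitStabilizer σ M₀).comap (unitNormMap σ 3) := by
    rw [hφ, ← MonoidHom.comap_ker, QuotientGroup.ker_mk']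
  have hinj : Function.Injective (fun θ : (Fin 3 → Kˣ) ⧸ fixedUnitStabilizer σ M₀ => φ u * θ) := fun a b h => by
    simpa only [inv_mul_cancel_left] using congrArg (fun θ => (φ u)⁻¹ * θ) h
  rw [hfun, ← Set.image_image (fun θ => φ u * θ) φ, Set.ncard_image_of_injective _ hinj, ← hker, Subgroup.relIndex_ker]
  exact (Nat.card_coe_set_eq _).symm

/-- **LATTICES OVER ONE CLASS, OCCUPIED CASE**: if `N(u₀)·S_F ∋ y` for some `u₀ ∈ 𝒯`, the lattices `diag(u)·M₀` (`u ∈ 𝒯`) with `N(u)·S_F ∋ y` form the translate by `u₀` of the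
`H`-orbit of `M₀`, `H = 𝒯 ∩ N⁻¹S_F`, of size `[H : S̃ ∩ H]` (★ PART 2 `ncard_translate_subgroup_orbit_eq_relIndex`). [cite: Kottwitz1986BaseChangeUnits, §1 pp. 240–241] -/
theorem ncard_orbit_inter_normClass_eq_relIndex (σ : K →+* K) (M₀ : Submodule 𝒪[K] (Fin 3 → K)) (y u₀ : Fin 3 → Kˣ) (hu₀ : u₀ ∈ unitTorus K 3)
    (h₀ : (unitNormMap σ 3 u₀)⁻¹ * y ∈ fixedUnitStabilizer σ M₀) :
    {M : Submodule 𝒪[K] (Fin 3 → K) | ∃ u ∈ unitTorus K 3, M = mapGL (diagGLUnits u) M₀ ∧ (unitNormMap σ 3 u)⁻¹ * y ∈ fixedUnitStabilizer σ M₀}.ncard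
      = (latticeStabilizer M₀).relIndex (unitTorus K 3 ⊓ (fixedUnitStabilizer σ M₀).comap (unitNormMap σ 3)) := by
  have upi : ∀ {x z : Fin 3 → Kˣ}, (∀ i, ((x i : Kˣ) : K) = z i) → x = z := fun h => funext fun i => Units.ext (h i)
  have hset : {M : Submodule 𝒪[K] (Fin 3 → K) | ∃ u ∈ unitTorus K 3, M = mapGL (diagGLUnits u) M₀ ∧ (unitNormMap σ 3 u)⁻¹ * y ∈ fixedUnitStabilizer σ M₀}
      = {M | ∃ h ∈ unitTorus K 3 ⊓ (fixedUnitStabilizer σ M₀).comap (unitNormMap σ 3), M = mapGL (diagGLUnits (u₀ * h)) M₀} := by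
    ext M
    simp only [Set.mem_setOf_eq]
    constructor
    · rintro ⟨u, hu, rfl, hy⟩
      refine ⟨u₀⁻¹ * u, Subgroup.mem_inf.2 ⟨(unitTorus K 3).mul_mem ((unitTorus K 3).inv_mem hu₀) hu, ?_⟩, by rw [mul_inv_cancel_left]⟩
      rw [Subgroup.mem_comap]
      have hid : unitNormMap σ 3 (u₀⁻¹ * u) = ((unitNormMap σ 3 u₀)⁻¹ * y) * ((unitNormMap σ 3 u)⁻¹ * y)⁻¹ := by
        rw [map_mul, map_inv]
        refine upi fun i => ?_
        simp only [Pi.mul_apply, Pi.inv_apply, Units.val_mul, Units.val_inv_eq_inv_val]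
        field_simp
      rw [hid]
      exact (fixedUnitStabilizer σ M₀).mul_mem h₀ ((fixedUnitStabilizer σ M₀).inv_mem hy)
    · rintro ⟨h, hh, rfl⟩
      obtain ⟨hhT, hhN⟩ := Subgroup.mem_inf.1 hh
      rw [Subgroup.mem_comap] at hhN
      refine ⟨u₀ * h, (unitTorus K 3).mul_mem hu₀ hhT, rfl, ?_⟩
      have hid : (unitNormMap σ 3 (u₀ * h))⁻¹ * y = ((unitNormMap σ 3 u₀)⁻¹ * y) * (unitNormMap σ 3 h)⁻¹ := by
        rw [map_mul]
        refine upi fun i => ?_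
        simp only [Pi.mul_apply, Pi.inv_apply, Units.val_mul, Units.val_inv_eq_inv_val]
        field_simp
      rw [hid]
      exact (fixedUnitStabilizer σ M₀).mul_mem h₀ ((fixedUnitStabilizer σ M₀).inv_mem hhN)
  rw [hset, ncard_translate_subgroup_orbit_eq_relIndex]

/-- **LATTICES OVER ONE CLASS, EMPTY CASE**: if no `u₀ ∈ 𝒯` has `N(u₀)·S_F ∋ y`, no lattice of the orbit lies over the class of `y`. [cite: Kottwitz1986BaseChangeUnits, §1 pp. 240–241] -/
theorem ncard_orbit_inter_normClass_eq_zero (σ : K →+* K) (M₀ : Submodule 𝒪[K] (Fin 3 → K)) (y : Fin 3 → Kˣ)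
    (h : ¬ ∃ u₀ ∈ unitTorus K 3, (unitNormMap σ 3 u₀)⁻¹ * y ∈ fixedUnitStabilizer σ M₀) :
    {M : Submodule 𝒪[K] (Fin 3 → K) | ∃ u ∈ unitTorus K 3, M = mapGL (diagGLUnits u) M₀ ∧ (unitNormMap σ 3 u)⁻¹ * y ∈ fixedUnitStabilizer σ M₀}.ncard = 0 := by
  have hset : {M : Submodule 𝒪[K] (Fin 3 → K) | ∃ u ∈ unitTorus K 3, M = mapGL (diagGLUnits u) M₀ ∧ (unitNormMap σ 3 u)⁻¹ * y ∈ fixedUnitStabilizer σ M₀} = ∅ := by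
    ext M
    simp only [Set.mem_setOf_eq, Set.mem_empty_iff_false, iff_false]
    rintro ⟨u, hu, -, hy⟩
    exact h ⟨u, hu, hy⟩
  rw [hset, Set.ncard_empty]


/-! ## §3  Four standalone pieces of the double count: the eight classes, occupied classes, slices, index algebra -/

/-- **`[𝒰 : N𝒯] = 8`**: the `c^{e}` (`e : Fin 3 → Bool`) represent `𝒰 ∕ N(𝒯)` (★ PART 2 `existsUnique_signVector_mem_map_unitNormMap`, counted by ★ PART 1
`card_filter_mem_coset_eq_relIndex` in the coset of `1`). [cite: Serre1979, Ch. V §3] -/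
theorem relIndex_map_unitNormMap_unitTorus_eq_eight {σ : K →+* K} (hσ : ∀ x, σ (σ x) = x) (hvσ : ∀ a, Valued.v (σ a) = Valued.v a)
    {c : K} (hσc : σ c = c) (hcv : Valued.v c = 1) (hc : ¬ ∃ z : K, z * σ z = c)
    (hdich : ∀ x : K, σ x = x → x ≠ 0 → (∃ z : K, z * σ z = x) ∨ ∃ z : K, z * σ z = c * x) :
    ((unitTorus K 3).map (unitNormMap σ 3)).relIndex (fixedUnitTorus σ 3) = 8 := by
  classical
  have hc0 : c ≠ 0 := fun h => by simp [h] at hcv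
  set cU : Kˣ := Units.mk0 c hc0 with hcUdef
  have hcU : (cU : K) = c := rfl
  set cvec : (Fin 3 → Bool) → (Fin 3 → Kˣ) := fun e i => if e i then cU else 1 with hcvec
  have hcvec_val : ∀ e i, ((cvec e i : Kˣ) : K) = if e i then c else 1 := by
    intro e i; by_cases h : e i <;> simp [hcvec, h, hcU]
  have hcvecU : ∀ e, cvec e ∈ fixedUnitTorus σ 3 := by
    intro e
    rw [mem_fixedUnitTorus_iff]
    refine ⟨fun i => ?_, fun i => ?_⟩
    · rw [hcvec_val]; by_cases h : e i <;> simp [h, hcv]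
    · rw [hcvec_val]; by_cases h : e i <;> simp [h, hσc]
  have hNT : (unitTorus K 3).map (unitNormMap σ 3) ≤ fixedUnitTorus σ 3 := map_unitNormMap_unitTorus_le hσ hvσ
  have hrep : ∀ x ∈ fixedUnitTorus σ 3, ∃! e : Fin 3 → Bool, x * (cvec e)⁻¹ ∈ (unitTorus K 3).map (unitNormMap σ 3) :=
    fun x hx => existsUnique_signVector_mem_map_unitNormMap hvσ hσc hcv hc hdich cU hcU x hx
  rw [← card_filter_mem_coset_eq_relIndex ((unitTorus K 3).map (unitNormMap σ 3)) (fixedUnitTorus σ 3) (fixedUnitTorus σ 3) hNT le_rfl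
    cvec hcvecU hrep 1 (Subgroup.one_mem _)]
  rw [Finset.filter_true_of_mem (fun e _ => by rw [inv_one, one_mul]; exact hcvecU e)]
  simp

/-- **OCCUPIED CLASSES**: the class of `w·x⁻¹` modulo `S_F(M₀)` is the class of some `N(u₀)`, `u₀ ∈ 𝒯`, iff `w⁻¹·x ∈ N(𝒯)·S_F(M₀)`. [cite: Kottwitz1986BaseChangeUnits, §1 pp. 240–241] -/
theorem exists_inv_unitNormMap_mul_mem_iff (σ : K →+* K) (M₀ : Submodule 𝒪[K] (Fin 3 → K)) (w x : Fin 3 → Kˣ) :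
    (∃ u₀ ∈ unitTorus K 3, (unitNormMap σ 3 u₀)⁻¹ * (w * x⁻¹) ∈ fixedUnitStabilizer σ M₀) ↔
      w⁻¹ * x ∈ (unitTorus K 3).map (unitNormMap σ 3) ⊔ latticeStabilizer M₀ ⊓ fixedUnitTorus σ 3 := by
  have upi : ∀ {y z : Fin 3 → Kˣ}, (∀ i, ((y i : Kˣ) : K) = z i) → y = z := fun h => funext fun i => Units.ext (h i)
  constructor
  · rintro ⟨u₀, hu₀, h⟩
    have hid : w⁻¹ * x = unitNormMap σ 3 u₀⁻¹ * ((unitNormMap σ 3 u₀)⁻¹ * (w * x⁻¹))⁻¹ := by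
      rw [map_inv]
      refine upi fun i => ?_
      simp only [Pi.mul_apply, Pi.inv_apply, Units.val_mul, Units.val_inv_eq_inv_val]
      field_simp
    rw [hid]
    exact Subgroup.mul_mem _ (Subgroup.mem_sup_left (Subgroup.mem_map_of_mem _ ((unitTorus K 3).inv_mem hu₀)))
      (Subgroup.mem_sup_right ((fixedUnitStabilizer σ M₀).inv_mem h))
  · intro h
    obtain ⟨x', hx', z, hz, hxz⟩ := Subgroup.mem_sup.1 h
    obtain ⟨t, ht, rfl⟩ := hx'
    refine ⟨t⁻¹, (unitTorus K 3).inv_mem ht, ?_⟩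
    have hid : (unitNormMap σ 3 t⁻¹)⁻¹ * (w * x⁻¹) = ((unitNormMap σ 3 t)⁻¹ * (w⁻¹ * x))⁻¹ := by
      rw [map_inv]
      refine upi fun i => ?_
      simp only [Pi.mul_apply, Pi.inv_apply, Units.val_mul, Units.val_inv_eq_inv_val]
      field_simp
    rw [hid, ← hxz, inv_mul_cancel_left]
    exact (fixedUnitStabilizer σ M₀).inv_mem hz

/-- **THE CLASSES OVER A LATTICE OF THE ORBIT**: for `u ∈ 𝒯`, the classes `θ` with `(diag(u)·M₀, θ) ∈ Ω` are `[S̃ : S̃ ∩ N⁻¹S_F]` in number (§2 `ncard_image_normClass_stabilizer`).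
[cite: Kottwitz1986BaseChangeUnits, §1 pp. 240–241] -/
theorem ncard_normClasses_over_lattice_eq (σ : K →+* K) (M₀ : Submodule 𝒪[K] (Fin 3 → K)) (u : Fin 3 → Kˣ) (hu : u ∈ unitTorus K 3) :
    {θ : (Fin 3 → Kˣ) ⧸ fixedUnitStabilizer σ M₀ | ∃ u' ∈ unitTorus K 3,
        (mapGL (diagGLUnits u) M₀, θ) = (mapGL (diagGLUnits u') M₀, ((QuotientGroup.mk' (fixedUnitStabilizer σ M₀)).comp (unitNormMap σ 3)) u')}.ncard
      = ((fixedUnitStabilizer σ M₀).comap (unitNormMap σ 3)).relIndex (unitStabilizer M₀) := by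
  rw [← ncard_image_normClass_stabilizer σ M₀ u]
  congr 1
  ext θ
  simp only [Set.mem_setOf_eq, Set.mem_image, Prod.mk.injEq, MonoidHom.comp_apply]
  constructor
  · rintro ⟨u', hu', hM, rfl⟩
    refine ⟨u⁻¹ * u', Subgroup.mem_inf.2 ⟨?_, (unitTorus K 3).mul_mem ((unitTorus K 3).inv_mem hu) hu'⟩, by rw [mul_inv_cancel_left]⟩
    rw [mem_latticeStabilizer_iff, map_mul, mapGL_mul, ← hM, ← mapGL_mul, ← map_mul, inv_mul_cancel, map_one, mapGL_one]
  · rintro ⟨s, hs, rfl⟩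
    obtain ⟨hsS, hsT⟩ := Subgroup.mem_inf.1 hs
    refine ⟨u * s, (unitTorus K 3).mul_mem hu hsT, ?_, rfl⟩
    rw [map_mul, mapGL_mul, (mem_latticeStabilizer_iff M₀ s).1 hsS]

open Classical in
/-- **THE LATTICES OVER A CLASS**: the members of `Ω = {(diag(u)·M₀, N(u)·S_F) : u ∈ 𝒯}` over the class of `y` number `[H : S̃ ∩ H]` (`H = 𝒯 ∩ N⁻¹S_F`) if that class meets
`N(𝒯)`, and `0` otherwise (§2). [cite: Kottwitz1986BaseChangeUnits, §1 pp. 240–241] -/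
theorem ncard_lattices_over_class_eq (σ : K →+* K) (M₀ : Submodule 𝒪[K] (Fin 3 → K)) (y : Fin 3 → Kˣ) :
    {ω ∈ {ω : Submodule 𝒪[K] (Fin 3 → K) × ((Fin 3 → Kˣ) ⧸ fixedUnitStabilizer σ M₀) | ∃ u ∈ unitTorus K 3,
        ω = (mapGL (diagGLUnits u) M₀, ((QuotientGroup.mk' (fixedUnitStabilizer σ M₀)).comp (unitNormMap σ 3)) u)} |
        ω.2 = QuotientGroup.mk' (fixedUnitStabilizer σ M₀) y}.ncard =
      if ∃ u₀ ∈ unitTorus K 3, (unitNormMap σ 3 u₀)⁻¹ * y ∈ fixedUnitStabilizer σ M₀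
      then (latticeStabilizer M₀).relIndex (unitTorus K 3 ⊓ (fixedUnitStabilizer σ M₀).comap (unitNormMap σ 3)) else 0 := by
  have hφeq : ∀ u : Fin 3 → Kˣ, ((QuotientGroup.mk' (fixedUnitStabilizer σ M₀)).comp (unitNormMap σ 3)) u =
      QuotientGroup.mk' (fixedUnitStabilizer σ M₀) y ↔ (unitNormMap σ 3 u)⁻¹ * y ∈ fixedUnitStabilizer σ M₀ := by
    intro u
    rw [MonoidHom.comp_apply, QuotientGroup.mk'_apply, QuotientGroup.mk'_apply, QuotientGroup.eq]
  have hset : {ω ∈ {ω : Submodule 𝒪[K] (Fin 3 → K) × ((Fin 3 → Kˣ) ⧸ fixedUnitStabilizer σ M₀) | ∃ u ∈ unitTorus K 3,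
        ω = (mapGL (diagGLUnits u) M₀, ((QuotientGroup.mk' (fixedUnitStabilizer σ M₀)).comp (unitNormMap σ 3)) u)} |
        ω.2 = QuotientGroup.mk' (fixedUnitStabilizer σ M₀) y} =
      (fun M => (M, QuotientGroup.mk' (fixedUnitStabilizer σ M₀) y)) ''
        {M : Submodule 𝒪[K] (Fin 3 → K) | ∃ u ∈ unitTorus K 3, M = mapGL (diagGLUnits u) M₀ ∧
          (unitNormMap σ 3 u)⁻¹ * y ∈ fixedUnitStabilizer σ M₀} := by
    ext ω
    simp only [Set.mem_setOf_eq, Set.mem_image]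
    constructor
    · rintro ⟨⟨u, hu, rfl⟩, hy⟩
      exact ⟨_, ⟨u, hu, rfl, (hφeq u).1 hy⟩, Prod.ext rfl hy.symm⟩
    · rintro ⟨M, ⟨u, hu, rfl, hy⟩, rfl⟩
      exact ⟨⟨u, hu, Prod.ext rfl ((hφeq u).2 hy).symm⟩, rfl⟩
  rw [hset, Set.ncard_image_of_injective _ (fun M M' h => (Prod.mk.inj h).1)]
  split_ifs with hex
  · obtain ⟨u₀, hu₀, h₀⟩ := hex
    exact ncard_orbit_inter_normClass_eq_relIndex σ M₀ y u₀ hu₀ h₀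
  · exact ncard_orbit_inter_normClass_eq_zero σ M₀ y hex

/-- **INDEX ALGEBRA IN THE TORUS**: `[S̃ : S̃ ∩ X]·[𝒯 : S̃] = [𝒯 ∩ X : S̃ ∩ X]·[𝒯 : 𝒯 ∩ X]` (both sides are `[𝒯 : S̃ ∩ X]`), for any subgroup `X`.
[cite: Kottwitz1986BaseChangeUnits, §1 pp. 240–241] -/
theorem relIndex_unitStabilizer_mul_relIndex_eq (M₀ : Submodule 𝒪[K] (Fin 3 → K)) (X : Subgroup (Fin 3 → Kˣ)) :
    X.relIndex (unitStabilizer M₀) * (unitStabilizer M₀).relIndex (unitTorus K 3) =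
      (latticeStabilizer M₀).relIndex (unitTorus K 3 ⊓ X) * X.relIndex (unitTorus K 3) := by
  have hST : unitStabilizer M₀ ≤ unitTorus K 3 := fun x hx => (Subgroup.mem_inf.1 hx).2
  have e1 : (unitStabilizer M₀ ⊓ X).relIndex (unitStabilizer M₀) * (unitStabilizer M₀).relIndex (unitTorus K 3) =
      (unitStabilizer M₀ ⊓ X).relIndex (unitTorus K 3) := Subgroup.relIndex_mul_relIndex _ _ _ inf_le_left hST
  have e2 : (unitStabilizer M₀ ⊓ X).relIndex (unitTorus K 3 ⊓ X) * (unitTorus K 3 ⊓ X).relIndex (unitTorus K 3) =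
      (unitStabilizer M₀ ⊓ X).relIndex (unitTorus K 3) :=
    Subgroup.relIndex_mul_relIndex _ _ _ (inf_le_inf_right X hST) inf_le_left
  have e3 : (unitStabilizer M₀ ⊓ X).relIndex (unitTorus K 3 ⊓ X) = (latticeStabilizer M₀).relIndex (unitTorus K 3 ⊓ X) := by
    rw [show unitStabilizer M₀ ⊓ X = latticeStabilizer M₀ ⊓ (unitTorus K 3 ⊓ X) from inf_assoc _ _ _, Subgroup.inf_relIndex_right]
  rw [Subgroup.inf_relIndex_left] at e1
  rw [e3, Subgroup.inf_relIndex_left] at e2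
  rw [e1, ← e2]

end Summit.HodgeConjecture.HodgeConjecture.Cruxes.H413.F0P3cDyRamDiagonalOrbitFibreCountMult

end
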